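import Summits.QuantumAdvantage.QuantumAdvantage.Theorems.CubicForrelationNearExactIsExactTwoModSixSecondLevelFour
import Summits.QuantumAdvantage.QuantumAdvantage.Theorems.CubicForrelationNearExactIsExactTwoModSixSecondLevelThree

/-!
# Crux `CubicForrelation.NearExactIsExact` (stmt-QuantumAdvantage-14043) — n = 20 at the SECOND boundary `63/64`, the TOP level:
  `W_g ∈ 1024ℤ` and `Φ ≥ 63/64` force `g` to be bent (two-sided), hence `Φ = 1`

Certificate seat `b2b-cforr-cert` (gen 9).  HONEST FRAMING: a theorem about cubic Boolean functions on 20 bits (finite slice `n = 20`; the top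
level of the case analysis of `Φ ≥ 63/64 ⇒ Φ = 1`, the `r = 3` member of `n ≡ 2 (mod 6)` where the general-`r` walk `tm2_second_high_levels`
does not apply) — NOT summit progress.

One-sidedly a non-bent cubic `g` on 20 bits with `W_g = 1024·w` has capacity `≤ 63/64` (level parity of degree `≤ 5`), so `Φ = 63/64` is not
excluded by counting.  Two-sidedly (`tw20_levelTen_bent`): the budget `Σ (w − s)² = 2²¹(1 − Φ)·2⁻⁶… ≤ 2¹⁵` is paid on the even set `Z` of `w`
(cost `≥ 1`), the zero set of the degree-`≤ 5` parity; `Z = ∅` gives bentness by Parseval; otherwise `#Z = 2¹⁵`, `Z` is a 15-flat of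
codimension FIVE (`mw_flat_of_minweight`), `e := w − s = ±1` on `Z`; five transversal directions (doubling, `fo_double_closed`, `fo_mem_flatPt`,
`fr_sum_peel`) localise the general 8- and 9-flat sums to (H3)/(H4) along `Z`, the engine `fl1_flat_l1` gives `Σ|(e1_Z)^| ≤ 2²¹` against the
pairing `2²⁴`.  With Hou (`tw_bent_end`: a bent cubic on 20 bits has `Φ = 1 ∨ Φ ≤ 31/32`): `tw20_levelTen_exact`, and with
`tm2_levelThree_false` (`r = 3`): `tw20_levels_exact` — `W_g ∈ 512ℤ ∧ Φ ≥ 63/64 ⇒ Φ = 1` on 20 bits.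

References: J. Ax (1964) / R. J. McEliece (1972); X.-D. Hou (1998); MacWilliams–Sloane (1977) Ch. 13–15; R. O'Donnell (2014) §3.3.
Everything below is proved from Mathlib and the tree; axioms are the standard three.
-/

set_option linter.dupNamespace false -- D-0017: single-problem summit ⇒ `QuantumAdvantage.QuantumAdvantage` by design

noncomputable section

namespace Summit.QuantumAdvantage.QuantumAdvantage.Theorems.CubicForrelation.NearExactIsExact

open Finset
open Literature.Computability.QuantumComplexity
open Literature.Computability.QuantumComplexity.BuzetChailloux (bxor zeroVec bxor_bxor_cancel_left bxor_zeroVec zeroVec_bxor bxor_comm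
  bxor_self)
open Literature.Computability.QuantumComplexity.DerivativeWalsh (W)

/-- **Level 10 at `Φ ≥ 63/64` on 20 bits forces bentness.**  For cubic `f, g : 𝔽₂²⁰ → 𝔽₂` with `W_g = 1024·w` and `Φ(f,g) ≥ 63/64`, every
`W_g(x)² = 2²⁰`.  Finite-slice statement; NOT summit progress. [this work] -/
theorem tw20_levelTen_bent (f g : (Fin (10 + 10) → Bool) → Bool) (hf : IsDegLeFun 3 f) (hg : IsDegLeFun 3 g)
    (w : (Fin (10 + 10) → Bool) → ℤ) (hw : ∀ x, W (fun y => signOf (g y)) x = (2 : ℝ) ^ 10 * (w x : ℝ))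
    (hΦ : (63 / 64 : ℝ) ≤ forrelation f g) : ∀ x, W (fun y => signOf (g y)) x ^ 2 = (2 : ℝ) ^ (10 + 10) := by
  classical
  have hP20 : ∑ x, W (fun y => signOf (g y)) x ^ 2 = (2 : ℝ) ^ 40 := by
    rw [DerivativeWalsh.sum_W_sq, sum_congr rfl fun y _ => BuzetChailloux.signOf_sq (g y), sum_const, card_univ, Fintype.card_fun,
      Fintype.card_bool, Fintype.card_fin]
    norm_num
  by_cases hall : ∀ x, Odd (w x)
  · have hsq : ∀ x, W (fun y => signOf (g y)) x ^ 2 = (2 : ℝ) ^ 20 * ((w x : ℝ)) ^ 2 := fun x => by rw [hw x]; ring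
    rw [sum_congr rfl fun x _ => hsq x, ← mul_sum] at hP20
    have hsum : ∑ x, ((w x : ℝ)) ^ 2 = (2 : ℝ) ^ 20 := by
      have h2 : (2 : ℝ) ^ 40 = 2 ^ 20 * 2 ^ 20 := by norm_num
      rw [h2] at hP20
      exact mul_left_cancel₀ (by positivity) hP20
    have hsumZ : (∑ x, (w x ^ 2 - 1) : ℤ) = 0 := by
      have h' : ((∑ x, (w x ^ 2 - 1) : ℤ) : ℝ) = 0 := by
        push_cast
        rw [sum_sub_distrib, hsum, sum_const, card_univ, Fintype.card_fun, Fintype.card_bool, Fintype.card_fin]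
        norm_num
      exact_mod_cast h'
    have hnn : ∀ x, (0 : ℤ) ≤ w x ^ 2 - 1 := by
      intro x
      have h0 := Int.odd_iff.1 (hall x)
      have : w x ≤ -1 ∨ 1 ≤ w x := by omega
      have := tp_sq_ge (k := 1) (by norm_num) this
      linarith
    intro x
    have hx : w x ^ 2 - 1 = 0 := (sum_eq_zero_iff_of_nonneg fun y _ => hnn y).1 hsumZ x (mem_univ x)
    have hx' : ((w x : ℝ)) ^ 2 = 1 := by exact_mod_cast (show w x ^ 2 = 1 by linarith)
    rw [hsq x, hx']; norm_num
  exfalso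
  push Not at hall
  obtain ⟨x₁, hx₁⟩ := hall
  -- `u = 8w` at the Ax level `7`
  set u : (Fin (10 + 10) → Bool) → ℤ := fun x => 8 * w x with hudef
  have hu : ∀ x, W (fun y => signOf (g y)) x = (2 : ℝ) ^ (2 * 3 + 1) * (u x : ℝ) := by
    intro x; rw [hw x]; simp only [u]; push_cast; ring
  -- the level parity has degree `≤ 5`, so has the indicator of the even set
  have hp : IsDegLeFun 5 (fun x => decide (Odd (w x))) :=
    stub_walshTower stub_axParity (10 + 10) 10 5 g w hg hw (by intro j hj hjn; omega)
  have hq : IsDegLeFun (4 + 1) (fun x => decide (Odd (w x)) ^^ true) := tb_isDegLeFun_xor_const hp true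
  -- budget `Σ (w − s)² ≤ 2¹⁵`
  have hbud := tms_budget 3 f g u hu
  have h64 : ∀ x, (u x - 2 ^ 3 * sZ (f x)) ^ 2 = 64 * (w x - sZ (f x)) ^ 2 := fun x => by simp only [u]; ring
  have hB : (∑ x, (w x - sZ (f x)) ^ 2 : ℤ) ≤ 2 ^ 15 := by
    have h' : ((∑ x, (u x - 2 ^ 3 * sZ (f x)) ^ 2 : ℤ) : ℝ) ≤ 2 ^ 21 := by rw [hbud]; norm_num at hΦ ⊢; nlinarith
    have h'' : (∑ x, (u x - 2 ^ 3 * sZ (f x)) ^ 2 : ℤ) ≤ 2 ^ 21 := by exact_mod_cast h'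
    rw [sum_congr rfl fun x _ => h64 x, ← mul_sum] at h''
    linarith
  -- RM: `#Z ≥ 2¹⁵` for the even set `Z`
  set P := univ.filter (fun x : Fin (10 + 10) → Bool => ¬ Odd (w x)) with hPdef
  have hmemP : ∀ x, x ∈ P ↔ ¬ Odd (w x) := fun x => by simp [hPdef]
  have hfilt : (univ.filter fun x : Fin (10 + 10) → Bool => (decide (Odd (w x)) ^^ true) = true) = P :=
    filter_congr fun x _ => by by_cases h : Odd (w x) <;> simp [h]
  have hRM := bb_rmWeight_holds (10 + 10) 5 (fun x => decide (Odd (w x)) ^^ true) hq ⟨x₁, by simp [hx₁]⟩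
  rw [hfilt] at hRM
  have hPge : 2 ^ 15 ≤ #P := by norm_num at hRM ⊢; omega
  -- everything is tight
  have hsumP : (∑ x, (if ¬ Odd (w x) then 1 else 0 : ℤ)) = #P := by rw [sum_boole]
  have hnonneg : ∀ x, 0 ≤ (w x - sZ (f x)) ^ 2 - (if ¬ Odd (w x) then 1 else 0 : ℤ) := by
    intro x
    by_cases h : Odd (w x)
    · rw [if_neg (not_not.2 h)]; have := sq_nonneg (w x - sZ (f x)); linarith
    · rw [if_pos h]
      have hodd' : Odd (w x - sZ (f x)) := by
        have hs : Odd (sZ (f x)) := by rcases tp_sZ_cases (f x) with e | e <;> rw [e] <;> decide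
        exact Int.odd_sub.2 (iff_of_false h (by simpa [Int.not_even_iff_odd] using hs))
      have h0 := Int.odd_iff.1 hodd'
      have : w x - sZ (f x) ≤ -1 ∨ 1 ≤ w x - sZ (f x) := by omega
      have := tp_sq_ge (k := 1) (by norm_num) this
      linarith
  have hPge' : (2 : ℤ) ^ 15 ≤ #P := by exact_mod_cast hPge
  have hsum0 : ∑ x, ((w x - sZ (f x)) ^ 2 - (if ¬ Odd (w x) then 1 else 0 : ℤ)) = 0 := by
    refine le_antisymm ?_ (sum_nonneg fun x _ => hnonneg x)
    rw [sum_sub_distrib, hsumP]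
    linarith
  have hzero' : ∀ x, (w x - sZ (f x)) ^ 2 - (if ¬ Odd (w x) then 1 else 0 : ℤ) = 0 :=
    fun x => (sum_eq_zero_iff_of_nonneg fun y _ => hnonneg y).1 hsum0 x (mem_univ x)
  have hoff : ∀ x, Odd (w x) → w x - sZ (f x) = 0 := by
    intro x hx
    have h := hzero' x
    rw [if_neg (not_not.2 hx), sub_zero] at h
    exact (pow_eq_zero_iff two_ne_zero).1 h
  have hon : ∀ x, ¬ Odd (w x) → w x - sZ (f x) = 1 ∨ w x - sZ (f x) = -1 := by
    intro x hx
    have h := hzero' x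
    rw [if_pos hx] at h
    have h1 : (w x - sZ (f x)) * (w x - sZ (f x)) = 1 := by rw [← pow_two]; linarith
    exact mul_self_eq_one_iff.1 h1
  have hPcard : #P = 2 ^ 15 := by
    have hle : (#P : ℤ) ≤ 2 ^ 15 := by
      rw [← hsumP]
      exact le_trans (sum_le_sum fun x _ => by have := hnonneg x; linarith) hB
    have hle' : #P ≤ 2 ^ 15 := by exact_mod_cast hle
    exact le_antisymm hle' hPge
  have hTeq : (2 : ℝ) ^ (8 * 3 + 3) * (1 - forrelation f g) = 2 ^ 21 := by
    have hT : (∑ x, (u x - 2 ^ 3 * sZ (f x)) ^ 2 : ℤ) = 2 ^ 21 := by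
      have e64 : ∀ x, (u x - 2 ^ 3 * sZ (f x)) ^ 2 = 64 * ((w x - sZ (f x)) ^ 2 - (if ¬ Odd (w x) then 1 else 0 : ℤ)) +
          64 * (if ¬ Odd (w x) then 1 else 0 : ℤ) := fun x => by rw [h64 x]; ring
      rw [sum_congr rfl fun x _ => e64 x, sum_add_distrib, ← mul_sum, ← mul_sum, hsum0, hsumP, hPcard]
      norm_num
    have h : ((∑ x, (u x - 2 ^ 3 * sZ (f x)) ^ 2 : ℤ) : ℝ) = 2 ^ 21 := by exact_mod_cast hT
    rw [hbud] at h
    exact h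
  -- `P` is a 15-flat
  have hmw := mw_flat_of_minweight 4 (fun x => decide (Odd (w x)) ^^ true) hq (by rw [hfilt, hPcard]; norm_num)
  rw [hfilt] at hmw
  obtain ⟨h0, hadd, hcardV, hcoset⟩ := hmw
  set V₀ := univ.filter (fun a : Fin (10 + 10) → Bool => ∀ x,
    (decide (Odd (w (bxor x a))) ^^ true) = (decide (Odd (w x)) ^^ true)) with hV₀
  have hS : P = V₀.image (bxor x₁) := hcoset x₁ (by simp [hx₁])
  rw [hPcard] at hcardV
  have hNcard : #(univ : Finset (Fin (10 + 10) → Bool)) = 2 ^ 20 := by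
    rw [card_univ, Fintype.card_fun, Fintype.card_bool, Fintype.card_fin]
  -- the sign pattern and the residual
  set e : (Fin (10 + 10) → Bool) → ℤ := fun x => w x - sZ (f x) with hedef
  have he : ∀ x ∈ P, e x = 1 ∨ e x = -1 := fun x hx => hon x ((hmemP x).1 hx)
  set F : (Fin (10 + 10) → Bool) → ℤ := fun y => u y - 2 ^ 3 * sZ (f y) with hFdef
  have hF0 : ∀ y, y ∉ P → F y = 0 := by
    intro y hy
    have := hoff y (not_not.1 fun h => hy ((hmemP y).2 h))
    simp only [F, u]; linarith
  have hFe : ∀ y, F y = 8 * e y := fun y => by simp only [F, u, e]; ring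
  have hPV : ∀ x, x ∈ P → ∀ a ∈ V₀, bxor x a ∈ P := fun x hx a ha => fl1_coset_vadd hadd hS hx ha
  -- peeling one transversal direction
  have hpeel : ∀ (U : Finset (Fin (10 + 10) → Bool)), zeroVec ∈ U → (∀ a ∈ U, ∀ b ∈ U, bxor a b ∈ U) → V₀ ⊆ U →
      ∀ t, t ∉ U → ∀ q, q ∈ P → ∀ {kk : ℕ} (a : Fin kk → Fin (10 + 10) → Bool), (∀ i, a i ∈ U) →
      ∑ ε : Fin (kk + 1) → Bool, F (fun j => q j ^^ decide (Odd #(univ.filter fun i =>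
          ε i && (Matrix.vecCons t a : Fin (kk + 1) → Fin (10 + 10) → Bool) i j))) =
        ∑ ε : Fin kk → Bool, F (fun j => q j ^^ decide (Odd #(univ.filter fun i => ε i && a i j))) := by
    intro U hU0 hUadd hVU t ht q hq kk a ha
    rw [fr_sum_peel F q t a]
    have hz : ∑ ε : Fin kk → Bool, F (bxor (fun j => q j ^^ decide (Odd #(univ.filter fun i => ε i && a i j))) t) = 0 := by
      refine sum_eq_zero fun ε _ => hF0 _ fun hmem => ?_
      set S := U.image (bxor q) with hSU
      have hpt : (fun j => q j ^^ decide (Odd #(univ.filter fun i => ε i && a i j))) ∈ S :=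
        fo_mem_flatPt U hU0 (· ∈ S) (fun x hx b hb => fl1_coset_vadd hUadd hSU hx hb)
          (show q ∈ S from mem_image.2 ⟨zeroVec, hU0, bxor_zeroVec q⟩) a ha ε
      apply fl1_coset_out hU0 hUadd hSU hpt ht
      have hq' : q ∈ V₀.image (bxor x₁) := hS ▸ hq
      have hmem' : bxor (fun j => q j ^^ decide (Odd #(univ.filter fun i => ε i && a i j))) t ∈ V₀.image (bxor x₁) := hS ▸ hmem
      obtain ⟨v, hv, hvx⟩ := mem_image.1 hmem'
      obtain ⟨v₀, hv₀, hv₀q⟩ := mem_image.1 hq'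
      refine mem_image.2 ⟨bxor v₀ v, hVU (hadd v₀ hv₀ v hv), ?_⟩
      rw [← hvx, ← hv₀q, iw_bxor_assoc, bxor_bxor_cancel_left]
    rw [hz, add_zero]
  -- five transversal directions by doubling
  have hpick : ∀ (U : Finset (Fin (10 + 10) → Bool)), #U < 2 ^ 20 → ∃ t, t ∉ U := fun U hU => by
    obtain ⟨t, -, ht⟩ := exists_mem_notMem_of_card_lt_card (hNcard ▸ hU); exact ⟨t, ht⟩
  obtain ⟨t₅, ht₅⟩ := hpick V₀ (by rw [hcardV]; norm_num)
  obtain ⟨h40, h4add, h4sub, h4t, h4card⟩ := fo_double_closed V₀ h0 hadd t₅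
  set U₄ := V₀ ∪ V₀.image (bxor t₅) with hU₄
  obtain ⟨t₄, ht₄⟩ := hpick U₄ (by rw [hcardV] at h4card; norm_num at h4card ⊢; omega)
  obtain ⟨h30, h3add, h3sub, h3t, h3card⟩ := fo_double_closed U₄ h40 h4add t₄
  set U₃ := U₄ ∪ U₄.image (bxor t₄) with hU₃
  obtain ⟨t₃, ht₃⟩ := hpick U₃ (by rw [hcardV] at h4card; norm_num at h4card ⊢; omega)
  obtain ⟨h20, h2add, h2sub, h2t, h2card⟩ := fo_double_closed U₃ h30 h3add t₃
  set U₂ := U₃ ∪ U₃.image (bxor t₃) with hU₂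
  obtain ⟨t₂, ht₂⟩ := hpick U₂ (by rw [hcardV] at h4card; norm_num at h4card ⊢; omega)
  obtain ⟨h10, h1add, h1sub, h1t, h1card⟩ := fo_double_closed U₂ h20 h2add t₂
  set U₁ := U₂ ∪ U₂.image (bxor t₂) with hU₁
  obtain ⟨t₁, ht₁⟩ := hpick U₁ (by rw [hcardV] at h4card; norm_num at h4card ⊢; omega)
  -- localisation of a `(kk+5)`-flat sum to the `kk`-flat inside `P`
  have hloc : ∀ q, q ∈ P → ∀ {kk : ℕ} (a : Fin kk → Fin (10 + 10) → Bool), (∀ i, a i ∈ V₀) →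
      ∑ ε : Fin (kk + 1 + 1 + 1 + 1 + 1) → Bool, F (fun j => q j ^^ decide (Odd #(univ.filter fun i =>
          ε i && (Matrix.vecCons t₁ (Matrix.vecCons t₂ (Matrix.vecCons t₃ (Matrix.vecCons t₄ (Matrix.vecCons t₅ a)))) :
            Fin (kk + 1 + 1 + 1 + 1 + 1) → Fin (10 + 10) → Bool) i j))) =
        ∑ ε : Fin kk → Bool, 8 * e (fun j => q j ^^ decide (Odd #(univ.filter fun i => ε i && a i j))) := by
    intro q hq kk a ha
    have m5 : ∀ i, (Matrix.vecCons t₅ a : Fin (kk + 1) → _) i ∈ U₄ := by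
      intro i; refine Fin.cases ?_ (fun i => ?_) i
      · exact h4t
      · simp only [Matrix.cons_val_succ]; exact h4sub (ha i)
    have m4 : ∀ i, (Matrix.vecCons t₄ (Matrix.vecCons t₅ a) : Fin (kk + 1 + 1) → _) i ∈ U₃ := by
      intro i; refine Fin.cases ?_ (fun i => ?_) i
      · exact h3t
      · simp only [Matrix.cons_val_succ]; exact h3sub (m5 i)
    have m3 : ∀ i, (Matrix.vecCons t₃ (Matrix.vecCons t₄ (Matrix.vecCons t₅ a)) : Fin (kk + 1 + 1 + 1) → _) i ∈ U₂ := by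
      intro i; refine Fin.cases ?_ (fun i => ?_) i
      · exact h2t
      · simp only [Matrix.cons_val_succ]; exact h2sub (m4 i)
    have m2 : ∀ i, (Matrix.vecCons t₂ (Matrix.vecCons t₃ (Matrix.vecCons t₄ (Matrix.vecCons t₅ a))) :
        Fin (kk + 1 + 1 + 1 + 1) → _) i ∈ U₁ := by
      intro i; refine Fin.cases ?_ (fun i => ?_) i
      · exact h1t
      · simp only [Matrix.cons_val_succ]; exact h1sub (m3 i)
    rw [hpeel U₁ h10 h1add (h4sub.trans (h3sub.trans (h2sub.trans h1sub))) t₁ ht₁ q hq _ m2,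
      hpeel U₂ h20 h2add (h4sub.trans (h3sub.trans h2sub)) t₂ ht₂ q hq _ m3,
      hpeel U₃ h30 h3add (h4sub.trans h3sub) t₃ ht₃ q hq _ m4,
      hpeel U₄ h40 h4add h4sub t₄ ht₄ q hq _ m5,
      hpeel V₀ h0 hadd subset_rfl t₅ ht₅ q hq a ha]
    exact sum_congr rfl fun ε _ => hFe _
  -- (H3) and (H4)
  have H3 : ∀ x ∈ P, ∀ a b c : Fin (10 + 10) → Bool, a ∈ V₀ → b ∈ V₀ → c ∈ V₀ →
      (4 : ℤ) ∣ ∑ ε : Fin 3 → Bool, e (fun j => x j ^^ decide (Odd #(univ.filter fun i =>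
        ε i && (![a, b, c] : Fin 3 → Fin (10 + 10) → Bool) i j))) := by
    intro x hx a b c ha hb hc
    have hdv := fs_flat_sum_dvd (e := 5) g u hg hu x ![t₁, t₂, t₃, t₄, t₅, a, b, c] (by norm_num)
    obtain ⟨zf, hzf⟩ := sl_sum_sZ_flat f hf x ![t₁, t₂, t₃, t₄, t₅, a, b, c]
    have hzf' : ∑ ε : Fin 8 → Bool, 2 ^ 3 * sZ (f (fun j => x j ^^ decide (Odd #(univ.filter fun i =>
          ε i && (![t₁, t₂, t₃, t₄, t₅, a, b, c] : Fin 8 → Fin (10 + 10) → Bool) i j)))) = 2 ^ 5 * (2 * zf) := by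
      rw [← mul_sum, hzf]; norm_num; ring
    have h32 : (2 : ℤ) ^ 5 ∣ ∑ ε : Fin 8 → Bool, F (fun j => x j ^^ decide (Odd #(univ.filter fun i =>
          ε i && (![t₁, t₂, t₃, t₄, t₅, a, b, c] : Fin 8 → Fin (10 + 10) → Bool) i j))) := by
      simp only [F]
      rw [sum_sub_distrib, hzf']
      exact dvd_sub hdv (Dvd.intro _ rfl)
    rw [hloc x hx ![a, b, c] (fun i => by fin_cases i <;> assumption), ← mul_sum,
      show (2 : ℤ) ^ 5 = 8 * 4 by norm_num] at h32
    exact (mul_dvd_mul_iff_left (by norm_num : (8 : ℤ) ≠ 0)).1 h32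
  have H4 : ∀ x ∈ P, ∀ a₀ a₁ a₂ a₃ : Fin (10 + 10) → Bool, a₀ ∈ V₀ → a₁ ∈ V₀ → a₂ ∈ V₀ → a₃ ∈ V₀ →
      (8 : ℤ) ∣ ∑ ε : Fin 4 → Bool, e (fun j => x j ^^ decide (Odd #(univ.filter fun i =>
        ε i && (![a₀, a₁, a₂, a₃] : Fin 4 → Fin (10 + 10) → Bool) i j))) := by
    intro x hx a₀ a₁ a₂ a₃ ha₀ ha₁ ha₂ ha₃
    have hdv := fs_flat_sum_dvd (e := 6) g u hg hu x ![t₁, t₂, t₃, t₄, t₅, a₀, a₁, a₂, a₃] (by norm_num)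
    obtain ⟨zf, hzf⟩ := sl_sum_sZ_flat f hf x ![t₁, t₂, t₃, t₄, t₅, a₀, a₁, a₂, a₃]
    have hzf' : ∑ ε : Fin 9 → Bool, 2 ^ 3 * sZ (f (fun j => x j ^^ decide (Odd #(univ.filter fun i =>
          ε i && (![t₁, t₂, t₃, t₄, t₅, a₀, a₁, a₂, a₃] : Fin 9 → Fin (10 + 10) → Bool) i j)))) = 2 ^ 6 * zf := by
      rw [← mul_sum, hzf]; norm_num; ring
    have h64' : (2 : ℤ) ^ 6 ∣ ∑ ε : Fin 9 → Bool, F (fun j => x j ^^ decide (Odd #(univ.filter fun i =>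
          ε i && (![t₁, t₂, t₃, t₄, t₅, a₀, a₁, a₂, a₃] : Fin 9 → Fin (10 + 10) → Bool) i j))) := by
      simp only [F]
      rw [sum_sub_distrib, hzf']
      exact dvd_sub hdv (Dvd.intro _ rfl)
    rw [hloc x hx ![a₀, a₁, a₂, a₃] (fun i => by fin_cases i <;> assumption), ← mul_sum,
      show (2 : ℤ) ^ 6 = 8 * 8 by norm_num] at h64'
    exact (mul_dvd_mul_iff_left (by norm_num : (8 : ℤ) ≠ 0)).1 h64'
  -- the engine and the pairing
  have hE := fl1_flat_l1 V₀ P x₁ h0 hadd hS e he H3 H4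
  set A : (Fin (10 + 10) → Bool) → ℝ := fun x => if x ∈ P then (e x : ℝ) else 0 with hA
  have hAτ : (fun x => (u x : ℝ) - (2 : ℝ) ^ 3 * signOf (f x)) = fun x => 8 * A x := by
    funext x
    have h2 : (u x : ℝ) - (2 : ℝ) ^ 3 * signOf (f x) = (((u x - 2 ^ 3 * sZ (f x) : ℤ)) : ℝ) := by
      push_cast; rw [tp_sZ_cast]; ring
    rw [h2]
    by_cases hx : x ∈ P
    · simp only [A, if_pos hx]
      have := hFe x; simp only [F] at this; rw [this]; push_cast; ring
    · simp only [A, if_neg hx]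
      have := hF0 x hx; simp only [F] at this; rw [this]; norm_num
  have hpair := tms_pairing 3 f g u hu
  rw [hAτ] at hpair
  have hpair' : ∑ y, signOf (g y) * W A y = (2 : ℝ) ^ 24 := by
    have e2 : ∀ y, signOf (g y) * W (fun x => 8 * A x) y = 8 * (signOf (g y) * W A y) := fun y => by
      rw [fl1_W_smul]; ring
    rw [sum_congr rfl fun y _ => e2 y, ← mul_sum,
      show (2 : ℝ) ^ (10 * 3 + 3) = 2 ^ 6 * 2 ^ (8 * 3 + 3) by norm_num, mul_assoc, hTeq] at hpair
    norm_num at hpair ⊢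
    linarith
  have hge : (2 : ℝ) ^ 24 ≤ ∑ y, |W A y| := by rw [← hpair']; exact fl1_pairing_le_l1 g (W A)
  have hsq : ((2 : ℝ) ^ 24) ^ 2 ≤ (∑ y, |W A y|) ^ 2 := pow_le_pow_left₀ (by positivity) hge 2
  have hEn : (∑ y, |W A y|) ^ 2 ≤ (2 : ℝ) ^ 42 := hE.trans (by norm_num)
  have hbig : (2 : ℝ) ^ 42 < ((2 : ℝ) ^ 24) ^ 2 := by norm_num
  linarith

/-- **Level 10 at the second boundary on 20 bits is exact:** `W_g ∈ 1024ℤ ∧ Φ ≥ 63/64 ⇒ Φ = 1` (bent by `tw20_levelTen_bent`, then Hou: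
a bent cubic on 20 bits has `Φ = 1 ∨ Φ ≤ 31/32`).  NOT summit progress. [this work] -/
theorem tw20_levelTen_exact (f g : (Fin (10 + 10) → Bool) → Bool) (hf : IsDegLeFun 3 f) (hg : IsDegLeFun 3 g)
    (w : (Fin (10 + 10) → Bool) → ℤ) (hw : ∀ x, W (fun y => signOf (g y)) x = (2 : ℝ) ^ 10 * (w x : ℝ))
    (hΦ : (63 / 64 : ℝ) ≤ forrelation f g) : forrelation f g = 1 := by
  rcases tw_bent_end (by norm_num : 3 ≤ 10) f g hf hg (tw20_levelTen_bent f g hf hg w hw hΦ) with h | h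
  · exact h
  · exfalso; norm_num at h; linarith

/-- **Levels `≥ 9` at the second boundary on 20 bits are exact:** for cubic `f, g : 𝔽₂²⁰ → 𝔽₂` with `W_g ∈ 512ℤ` and `Φ(f,g) ≥ 63/64`,
`Φ(f,g) = 1` (`tm2_levelThree_false` at `r = 3` for level 9, `tw20_levelTen_exact` above it).  NOT summit progress. [this work] -/
theorem tw20_levels_exact (f g : (Fin (10 + 10) → Bool) → Bool) (hf : IsDegLeFun 3 f) (hg : IsDegLeFun 3 g)
    (w : (Fin (10 + 10) → Bool) → ℤ) (hw : ∀ x, W (fun y => signOf (g y)) x = (2 : ℝ) ^ 9 * (w x : ℝ))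
    (hΦ : (63 / 64 : ℝ) ≤ forrelation f g) : forrelation f g = 1 := by
  have hΦ' : 1 - (1 / 2 : ℝ) ^ (2 * 3) ≤ forrelation f g := by norm_num; exact hΦ
  by_cases h9 : ∃ x, Odd (w x)
  · exact (tm2_levelThree_false 3 le_rfl f g hf hg w (fun x => (hw x).trans (by norm_num)) h9 hΦ').elim
  · push Not at h9
    have hw' := tw_level_up g w hw h9
    exact tw20_levelTen_exact f g hf hg (fun x => w x / 2) (fun x => (hw' x).trans (by norm_num)) hΦ

end Summit.QuantumAdvantage.QuantumAdvantage.Theorems.CubicForrelation.NearExactIsExact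

end
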